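import Literature.Topology.PlanarFoliations.Punctures
import HarnessLib

/-!
# Prong stars: the local model of a saddle puncture of a planar foliation

Topic: Topology / PlanarFoliations. Let `F` be a foliation of a plane domain `X ↪ ℂ` (the
embedding `ι`), and `v` a point of the plane off `X` (a puncture). An **`n`-prong star at `v`**
is the `C⁰` form of an `n/2`-saddle of a singular foliation (`n = 4`: the ordinary saddle
`x² - y²`; Camacho–Lins Neto, *Geometric Theory of Foliations*, Ch. VI §2 "saddles", Ch. VII §2)
that needs no chart *at* the singular point: `n` compact **sectors** `S j` (`j ∈ ℤ/n`) around
`v`, covering a neighbourhood of `v`, each carrying **half flow box coordinates**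
`z ↦ (b j z, H z)` — a homeomorphism of `S j` onto the half square `[0, ρ] × [-ρ, ρ]` sending
`v` to `(0, 0)`, in which the plaques of `F` are the horizontals (the height `H` is common to
all sectors and locally increasing with the heights of the flow boxes of `F`), consecutive
sectors being glued along the half axes `{b = 0, ± H ≥ 0}` with alternating signs. This is the
structure of the contour foliation of a disc in checkerboard cone position at an interior
vertex (the four sectors around the four half edges, cut out by the diagonals of the squares;
established in `Literature/Topology/FourManifolds/`); here we record the abstract structure
and its first consequences:

* `ProngStar` (**definition**), `ProngStar.chart`, `ProngStar.rect`, `ProngStar.pt`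
  (**definitions**: the coordinates, the half square, the inverse coordinates);
* `ProngStar.continuousOn_pt`, `ProngStar.exists_dist_pt_lt`, `ProngStar.exists_norm_chart_lt`,
  `ProngStar.exists_le_dist_pt` (**proved**: the coordinates are a homeomorphism; points with
  `b ≥ ρ / 2` stay at a positive distance from `v`);
* `ProngStar.mem_leaf_of_horizontal` (**proved**, the main lemma): two points of a sector on a
  common horizontal `H = h` of the half square (avoiding `v`) lie on the same leaf of `F`
  — continuation of plaques along the horizontal, a clopen argument on the parameter interval;
* `ProngStar.prong_mem_leaf` (**proved**): the **prong** `{b > 0, H = 0}` of each sector lies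
  in one leaf;
* `ProngStar.exists_mem_leaf_outer` / `ProngStar.H_eq_zero_of_forall_dist_lt` (**proved**):
  a leaf through a point of a sector at height `h ≠ 0` reaches the outer edge `b = ρ` of the
  sector at the same height, hence leaves the ball of radius `c` around `v`; so a leaf staying
  within distance `c` of `v` meets the star only along the prongs ("no elliptic sector, no
  small closed leaves around a saddle").

## References

* C. Camacho, A. Lins Neto, *Geometric Theory of Foliations*, Birkhäuser (1985), Ch. VI §2,
  Ch. VII §2 [CamachoLinsNeto1985].
* I. Tamura, *Topology of Foliations* (Iwanami 1976; AMS 1992), §25, Lemma 6.6 [Tamura1992].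
-/

noncomputable section

open Set Filter Function Metric
open _root_.Topology
open Literature.Topology.FourManifolds Literature.Topology.FourManifolds.Foliation

namespace Literature.Topology.PlanarFoliations

variable {X : Type*} [TopologicalSpace X] {F : Foliation ℝ X} {ι : X → ℂ} {v : ℂ} {n : ℕ}

/-- **An `n`-prong star at `v`** for the planar foliation `F` of `X ↪ ℂ`: `n` compact sectors
`S j` around `v` with half flow box coordinates `(b j, H)` onto `[0, ρ] × [-ρ, ρ]`, glued along
the half axes with alternating signs `sg j`, foliated by the horizontals off `v`. See the module
docstring. [cite: CamachoLinsNeto1985, Ch. VI §2] -/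
structure ProngStar (F : Foliation ℝ X) (ι : X → ℂ) (v : ℂ) (n : ℕ) where
  /-- The sectors, indexed by `ℤ/n`. -/
  S : ZMod n → Set ℂ
  /-- The sector coordinate (distance from the axis, in the model). -/
  b : ZMod n → ℂ → ℝ
  /-- The common height. -/
  H : ℂ → ℝ
  /-- The signs selecting the half axis shared with the next sector. -/
  sg : ZMod n → ℝ
  /-- The size of the half squares. -/
  ρ : ℝ
  /-- The size is positive. -/
  ρ_pos : 0 < ρ
  /-- The signs are `±1`. -/
  sg_sq : ∀ j, sg j = 1 ∨ sg j = -1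
  /-- The signs alternate. -/
  sg_succ : ∀ j, sg (j + 1) = -sg j
  /-- The sectors are compact. -/
  isCompact : ∀ j, IsCompact (S j)
  /-- The sectors contain `v`. -/
  mem : ∀ j, v ∈ S j
  /-- The star is a neighbourhood of `v`. -/
  iUnion_mem_nhds : (⋃ j, S j) ∈ 𝓝 v
  /-- `v` has height `0`. -/
  H_v : H v = 0
  /-- `v` is on the axis of every sector. -/
  b_v : ∀ j, b j v = 0
  /-- The height is continuous on each sector. -/
  continuousOn_H : ∀ j, ContinuousOn H (S j)
  /-- The sector coordinate is continuous on the sector. -/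
  continuousOn_b : ∀ j, ContinuousOn (b j) (S j)
  /-- The coordinates are injective on the sector. -/
  injOn : ∀ j, InjOn (fun z ↦ (b j z, H z)) (S j)
  /-- The coordinates map the sector onto the half square. -/
  image_eq : ∀ j, (fun z ↦ (b j z, H z)) '' S j = Icc 0 ρ ×ˢ Icc (-ρ) ρ
  /-- Consecutive sectors meet along a half axis, seen from the first sector. -/
  inter_succ : ∀ j, S j ∩ S (j + 1) = {z ∈ S j | b j z = 0 ∧ 0 ≤ sg j * H z}
  /-- Consecutive sectors meet along a half axis, seen from the second sector. -/
  inter_succ' : ∀ j, S j ∩ S (j + 1) = {z ∈ S (j + 1) | b (j + 1) z = 0 ∧ 0 ≤ sg j * H z}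
  /-- The axis of a sector is covered by its two neighbours. -/
  axis_subset : ∀ j, {z ∈ S j | b j z = 0} ⊆ S (j - 1) ∪ S (j + 1)
  /-- Off `v`, only consecutive sectors meet. -/
  eq_of_mem_inter : ∀ i j, ∀ z ∈ S i ∩ S j, z ≠ v → j = i ∨ j = i + 1 ∨ i = j + 1
  /-- Off `v`, the sectors lie in the domain of the foliation. -/
  diff_subset_range : ∀ j, S j \ {v} ⊆ range ι
  /-- `v` itself is not in the domain. -/
  not_mem_range : v ∉ range ι
  /-- **Foliated**: near each point of a sector, the heights of a flow box of `F` increase with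
  `H`. -/
  foliated : ∀ j (x : X), ι x ∈ S j → ∃ e ∈ F.atlas, x ∈ e.source ∧ ∃ U ∈ 𝓝 x,
    ∀ y ∈ U, ι y ∈ S j → ∀ z ∈ U, ι z ∈ S j → ((e y).2 < (e z).2 ↔ H (ι y) < H (ι z))

namespace ProngStar

variable (P : ProngStar F ι v n)

/-! ## The coordinates and their inverse -/

/-- The half flow box coordinates of the sector `j`. [folklore] -/
def chart (j : ZMod n) (z : ℂ) : ℝ × ℝ := (P.b j z, P.H z)

/-- The model half square `[0, ρ] × [-ρ, ρ]`. [folklore] -/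
def rect : Set (ℝ × ℝ) := Icc 0 P.ρ ×ˢ Icc (-P.ρ) P.ρ

/-- The inverse coordinates of the sector `j` (values in the sector on the half square).
[folklore] -/
def pt (j : ZMod n) : ℝ × ℝ → ℂ := invFunOn (P.chart j) (P.S j)

/-- Unfolding lemma for `chart`. [folklore] -/
@[simp] theorem chart_apply (j : ZMod n) (z : ℂ) : P.chart j z = (P.b j z, P.H z) := rfl

/-- Unfolding lemma for `rect`. [folklore] -/
theorem mem_rect_iff {p : ℝ × ℝ} : p ∈ P.rect ↔ p.1 ∈ Icc 0 P.ρ ∧ p.2 ∈ Icc (-P.ρ) P.ρ := mem_prod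

/-- The coordinates are continuous on the sector. [folklore] -/
theorem continuousOn_chart (j : ZMod n) : ContinuousOn (P.chart j) (P.S j) :=
  (P.continuousOn_b j).prodMk (P.continuousOn_H j)

/-- The coordinates are injective on the sector. [folklore] -/
theorem injOn_chart (j : ZMod n) : InjOn (P.chart j) (P.S j) := P.injOn j

/-- The image of the sector is the half square. [folklore] -/
theorem chart_image (j : ZMod n) : P.chart j '' P.S j = P.rect := P.image_eq j

/-- The coordinates of a point of the sector lie in the half square. [folklore] -/
theorem chart_mem_rect {j : ZMod n} {z : ℂ} (hz : z ∈ P.S j) : P.chart j z ∈ P.rect := by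
  rw [← P.chart_image j]; exact mem_image_of_mem _ hz

/-- The coordinates of `v` are `(0, 0)`. [folklore] -/
@[simp] theorem chart_v (j : ZMod n) : P.chart j v = 0 := by
  simp [chart_apply, P.b_v j, P.H_v]

/-- `(0, 0)` lies in the half square. [folklore] -/
theorem zero_mem_rect : (0 : ℝ × ℝ) ∈ P.rect := by
  have := P.ρ_pos
  exact ⟨⟨le_rfl, this.le⟩, ⟨by simp [this.le], this.le⟩⟩

/-- The inverse coordinates take values in the sector and invert the coordinates, on the half
square. [folklore] -/
theorem pt_spec {j : ZMod n} {p : ℝ × ℝ} (hp : p ∈ P.rect) : P.pt j p ∈ P.S j ∧ P.chart j (P.pt j p) = p := by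
  have h : p ∈ P.chart j '' P.S j := by rw [P.chart_image j]; exact hp
  exact ⟨invFunOn_mem h, invFunOn_eq h⟩

/-- The inverse coordinates take values in the sector. [folklore] -/
theorem pt_mem {j : ZMod n} {p : ℝ × ℝ} (hp : p ∈ P.rect) : P.pt j p ∈ P.S j := (P.pt_spec hp).1

/-- The coordinates of the inverse coordinates. [folklore] -/
@[simp] theorem chart_pt {j : ZMod n} {p : ℝ × ℝ} (hp : p ∈ P.rect) : P.chart j (P.pt j p) = p := (P.pt_spec hp).2

/-- The sector coordinate of the inverse coordinates. [folklore] -/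
theorem b_pt {j : ZMod n} {p : ℝ × ℝ} (hp : p ∈ P.rect) : P.b j (P.pt j p) = p.1 :=
  congrArg Prod.fst (P.chart_pt hp)

/-- The height of the inverse coordinates. [folklore] -/
theorem H_pt {j : ZMod n} {p : ℝ × ℝ} (hp : p ∈ P.rect) : P.H (P.pt j p) = p.2 :=
  congrArg Prod.snd (P.chart_pt hp)

/-- The inverse coordinates invert the coordinates on the sector. [folklore] -/
@[simp] theorem pt_chart {j : ZMod n} {z : ℂ} (hz : z ∈ P.S j) : P.pt j (P.chart j z) = z :=
  (P.injOn_chart j).leftInvOn_invFunOn hz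

/-- The inverse coordinates of `(0, 0)` are `v`. [folklore] -/
@[simp] theorem pt_zero (j : ZMod n) : P.pt j 0 = v := by
  rw [← P.chart_v j, P.pt_chart (P.mem j)]

/-- The inverse coordinates of a point of the half square other than `(0, 0)` are not `v`.
[folklore] -/
theorem pt_ne {j : ZMod n} {p : ℝ × ℝ} (hp : p ∈ P.rect) (hp0 : p ≠ 0) : P.pt j p ≠ v := fun h ↦
  hp0 (by rw [← P.chart_pt hp (j := j), h, P.chart_v])

/-- The inverse of a continuous injection on a compact set is continuous on the image.
[folklore] -/
private theorem continuousOn_invFunOn_aux {A Y : Type*} [TopologicalSpace A] [TopologicalSpace Y]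
    [T2Space Y] [Nonempty A] {s : Set A} (hs : IsCompact s) {f : A → Y} (hf : ContinuousOn f s)
    (hinj : InjOn f s) : ContinuousOn (invFunOn f s) (f '' s) := by
  rw [continuousOn_iff_isClosed]
  intro C hC
  refine ⟨f '' (s ∩ C), ((hs.inter_right hC).image_of_continuousOn (hf.mono inter_subset_left)).isClosed, ?_⟩
  ext y
  constructor
  · rintro ⟨hyC, x, hx, rfl⟩
    exact ⟨⟨invFunOn f s (f x), ⟨invFunOn_mem ⟨x, hx, rfl⟩, hyC⟩, invFunOn_eq ⟨x, hx, rfl⟩⟩, x, hx, rfl⟩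
  · rintro ⟨⟨x, ⟨hxs, hxC⟩, rfl⟩, -⟩
    refine ⟨?_, x, hxs, rfl⟩
    show invFunOn f s (f x) ∈ C
    rw [hinj.leftInvOn_invFunOn hxs]
    exact hxC

/-- **The inverse coordinates are continuous on the half square.** [folklore] -/
theorem continuousOn_pt (j : ZMod n) : ContinuousOn (P.pt j) P.rect := by
  rw [← P.chart_image j]
  exact continuousOn_invFunOn_aux (P.isCompact j) (P.continuousOn_chart j) (P.injOn_chart j)

/-- **Points of the half square close to `(0, 0)` have inverse coordinates close to `v`.**
[folklore] -/
theorem exists_dist_pt_lt (j : ZMod n) {ε : ℝ} (hε : 0 < ε) :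
    ∃ δ > (0 : ℝ), ∀ p ∈ P.rect, ‖p‖ < δ → dist (P.pt j p) v < ε := by
  have hc : ContinuousWithinAt (P.pt j) P.rect 0 := P.continuousOn_pt j 0 P.zero_mem_rect
  have h := Metric.continuousWithinAt_iff.1 hc ε hε
  obtain ⟨δ, hδ, hball⟩ := h
  refine ⟨δ, hδ, fun p hp hpδ ↦ ?_⟩
  have := hball hp (by simpa using hpδ)
  rwa [P.pt_zero] at this

/-- **Points of a sector close to `v` have coordinates close to `(0, 0)`.** [folklore] -/
theorem exists_norm_chart_lt (j : ZMod n) {δ : ℝ} (hδ : 0 < δ) :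
    ∃ ε > (0 : ℝ), ∀ z ∈ P.S j, dist z v < ε → ‖P.chart j z‖ < δ := by
  have hc : ContinuousWithinAt (P.chart j) (P.S j) v := P.continuousOn_chart j v (P.mem j)
  obtain ⟨ε, hε, hball⟩ := Metric.continuousWithinAt_iff.1 hc δ hδ
  refine ⟨ε, hε, fun z hz hzε ↦ ?_⟩
  have := hball hz hzε
  rwa [P.chart_v, dist_zero_right] at this

/-- **The outer halves of the sectors stay away from `v`**: there is `c > 0` such that every
point of a sector with sector coordinate at least `ρ / 2` is at distance at least `c` from
`v`. [folklore] -/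
theorem exists_le_dist (hn : NeZero n) : ∃ c > (0 : ℝ), ∀ j, ∀ z ∈ P.S j, P.ρ / 2 ≤ P.b j z → c ≤ dist z v := by
  -- the union of the outer halves is compact and misses `v`
  set K : Set ℂ := ⋃ j, {z ∈ P.S j | P.ρ / 2 ≤ P.b j z} with hK
  have hKc : IsCompact K := by
    refine isCompact_iUnion fun j ↦ ?_
    have hcl : IsClosed {z ∈ P.S j | P.ρ / 2 ≤ P.b j z} := by
      have := (P.continuousOn_b j).preimage_isClosed_of_isClosed (P.isCompact j).isClosed (isClosed_Ici (a := P.ρ / 2))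
      simpa [inter_comm, Set.preimage, setOf_and] using this
    exact (P.isCompact j).of_isClosed_subset hcl fun z hz ↦ hz.1
  have hvK : v ∉ K := by
    simp only [hK, mem_iUnion, mem_setOf_eq, not_exists, not_and, not_le]
    intro j _
    rw [P.b_v j]
    linarith [P.ρ_pos]
  rcases eq_empty_or_nonempty K with hKe | hKne
  · exact ⟨1, one_pos, fun j z hz hb ↦ by
      have : z ∈ K := mem_iUnion.2 ⟨j, hz, hb⟩
      rw [hKe] at this; exact absurd this (notMem_empty z)⟩
  · have hpos : 0 < infDist v K := (hKc.isClosed.notMem_iff_infDist_pos hKne).1 hvK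
    refine ⟨infDist v K, hpos, fun j z hz hb ↦ ?_⟩
    have hzK : z ∈ K := mem_iUnion.2 ⟨j, hz, hb⟩
    rw [dist_comm]
    exact infDist_le_dist_of_mem hzK

/-! ## Leaves along the horizontals -/

section Leaves

variable (hι : IsOpenEmbedding ι)
include hι

omit hι in
/-- A point of a sector other than `v` is the image of a point of the domain. [folklore] -/
theorem exists_eq_of_mem {j : ZMod n} {z : ℂ} (hz : z ∈ P.S j) (hzv : z ≠ v) : ∃ x : X, ι x = z :=
  P.diff_subset_range j ⟨hz, hzv⟩

omit hι in
/-- A point of the domain is not `v`. [folklore] -/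
theorem ne_v (P : ProngStar F ι v n) (x : X) : ι x ≠ v := fun h ↦ P.not_mem_range ⟨x, h⟩

omit hι in
/-- **Plaques near a point of a sector are horizontals**: near `x` with `ι x ∈ S j`, points of
the sector at the height of `x` lie on the leaf of `x`. [folklore] -/
theorem eventually_mem_leaf {j : ZMod n} {x : X} (hx : ι x ∈ P.S j) :
    ∀ᶠ y in 𝓝 x, ι y ∈ P.S j → P.H (ι y) = P.H (ι x) → y ∈ F.leaf x := by
  obtain ⟨e, he, hxe, U, hU, hmono⟩ := P.foliated j x hx
  filter_upwards [hU, e.open_source.mem_nhds hxe] with y hyU hye hyS hH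
  have hxU : x ∈ U := mem_of_mem_nhds hU
  have h₁ := hmono y hyU hyS x hxU hx
  have h₂ := hmono x hxU hx y hyU hyS
  have heq : (e y).2 = (e x).2 := by
    rcases lt_trichotomy ((e y).2) ((e x).2) with h | h | h
    · exact absurd (h₁.1 h) (by rw [hH]; exact lt_irrefl _)
    · exact h
    · exact absurd (h₂.1 h) (by rw [hH]; exact lt_irrefl _)
  exact (F.samePlaque_of_mem_plaque he (mem_plaque_self hxe) ⟨hye, heq⟩).mem_leaf

/-- **Continuation of plaques along a horizontal of a sector**: for `β₁ ≤ β₂` and a height `h`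
with the segment `[β₁, β₂] × {h}` in the half square and off `(0, 0)`, the points of the domain
over its endpoints lie on the same leaf. [folklore] -/
theorem mem_leaf_of_horizontal {j : ZMod n} {β₁ β₂ h : ℝ} (hβ : β₁ ≤ β₂) (h₁ : (β₁, h) ∈ P.rect) (h₂ : (β₂, h) ∈ P.rect)
    (hoff : h ≠ 0 ∨ 0 < β₁) {x y : X} (hx : ι x = P.pt j (β₁, h)) (hy : ι y = P.pt j (β₂, h)) :
    y ∈ F.leaf x := by
  -- all the points of the segment are in the half square and off `(0, 0)`
  have hmem : ∀ β ∈ Icc β₁ β₂, (β, h) ∈ P.rect := fun β hb ↦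
    ⟨⟨h₁.1.1.trans hb.1, hb.2.trans h₂.1.2⟩, h₁.2⟩
  have hne : ∀ β ∈ Icc β₁ β₂, ((β, h) : ℝ × ℝ) ≠ 0 := fun β hb h0 ↦ by
    simp only [Prod.ext_iff, Prod.fst_zero, Prod.snd_zero] at h0
    rcases hoff with hh | hb₁
    · exact hh h0.2
    · linarith [hb.1, h0.1]
  -- the points of the domain over the segment
  have hpre : ∀ β ∈ Icc β₁ β₂, ∃ x' : X, ι x' = P.pt j (β, h) := fun β hb ↦
    P.exists_eq_of_mem (P.pt_mem (hmem β hb)) (P.pt_ne (hmem β hb) (hne β hb))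
  haveI : Nonempty X := ⟨x⟩
  choose! ξ hξ using hpre
  -- `ξ` is continuous on the segment
  have hcont : ContinuousOn ξ (Icc β₁ β₂) := by
    have hιξ : ContinuousOn (ι ∘ ξ) (Icc β₁ β₂) := by
      have hc : ContinuousOn (fun β : ℝ ↦ P.pt j (β, h)) (Icc β₁ β₂) :=
        (P.continuousOn_pt j).comp (continuous_id.prodMk continuous_const).continuousOn hmem
      exact hc.congr fun β hb ↦ hξ β hb
    exact hι.isEmbedding.continuousOn_iff.2 hιξ
  -- the clopen set of parameters whose point is on the leaf of `x`
  have key : ∀ β ∈ Icc β₁ β₂, ∀ᶠ β' in 𝓝[Icc β₁ β₂] β, (ξ β' ∈ F.leaf x ↔ ξ β ∈ F.leaf x) := by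
    intro β hb
    have hS : ι (ξ β) ∈ P.S j := by rw [hξ β hb]; exact P.pt_mem (hmem β hb)
    have hev := P.eventually_mem_leaf hS
    have htend : Tendsto ξ (𝓝[Icc β₁ β₂] β) (𝓝 (ξ β)) := hcont β hb
    filter_upwards [htend.eventually hev, self_mem_nhdsWithin] with β' hβ' hb'
    have hS' : ι (ξ β') ∈ P.S j := by rw [hξ β' hb']; exact P.pt_mem (hmem β' hb')
    have hH : P.H (ι (ξ β')) = P.H (ι (ξ β)) := by
      rw [hξ β' hb', hξ β hb, P.H_pt (hmem β' hb'), P.H_pt (hmem β hb)]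
    have hleaf : ξ β' ∈ F.leaf (ξ β) := hβ' hS' hH
    constructor
    · intro h'
      rw [← leaf_eq_of_mem h', mem_leaf_comm]
      exact hleaf
    · intro h'
      rw [← leaf_eq_of_mem h']
      exact hleaf
  -- connectedness of the segment: the set of good parameters is clopen
  have hx' : ξ β₁ = x := hι.injective (by rw [hξ β₁ ⟨le_rfl, hβ⟩, hx])
  have hy' : ξ β₂ = y := hι.injective (by rw [hξ β₂ ⟨hβ, le_rfl⟩, hy])
  haveI : PreconnectedSpace (Icc β₁ β₂) := Subtype.preconnectedSpace isPreconnected_Icc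
  set A : Set (Icc β₁ β₂) := {b | ξ b ∈ F.leaf x} with hA
  have hnhds : ∀ b : Icc β₁ β₂, ∀ᶠ b' : Icc β₁ β₂ in 𝓝 b, (ξ (b' : ℝ) ∈ F.leaf x ↔ ξ (b : ℝ) ∈ F.leaf x) := by
    rintro ⟨β, hb⟩
    have h := key β hb
    rw [nhdsWithin_eq_map_subtype_coe hb, eventually_map] at h
    exact h
  have hopen : IsOpen A := isOpen_iff_mem_nhds.2 fun b hb ↦ (hnhds b).mono fun b' h ↦ h.2 hb
  have hcompl : IsOpen Aᶜ := isOpen_iff_mem_nhds.2 fun b hb ↦ (hnhds b).mono fun b' h h' ↦ hb (h.1 h')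
  have hclopen : IsClopen A := ⟨isOpen_compl_iff.1 hcompl, hopen⟩
  rcases isClopen_iff.1 hclopen with h0 | huniv
  · have : (⟨β₁, le_rfl, hβ⟩ : Icc β₁ β₂) ∈ A := by
      show ξ β₁ ∈ F.leaf x
      rw [hx']; exact F.mem_leaf_self x
    rw [h0] at this
    exact absurd this (notMem_empty _)
  · have : (⟨β₂, hβ, le_rfl⟩ : Icc β₁ β₂) ∈ A := by rw [huniv]; exact mem_univ _
    have : ξ β₂ ∈ F.leaf x := this
    rwa [hy'] at this

/-- **The prong of a sector lies in one leaf**: the points over `(β, 0)` and `(β', 0)`,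
`0 < β, β' ≤ ρ`, lie on the same leaf. [folklore] -/
theorem prong_mem_leaf {j : ZMod n} {β β' : ℝ} (hβ : β ∈ Ioc 0 P.ρ) (hβ' : β' ∈ Ioc 0 P.ρ) {x y : X}
    (hx : ι x = P.pt j (β, 0)) (hy : ι y = P.pt j (β', 0)) : y ∈ F.leaf x := by
  have hr : ∀ {b : ℝ}, b ∈ Ioc 0 P.ρ → ((b, (0 : ℝ)) : ℝ × ℝ) ∈ P.rect := fun {b} hb ↦
    ⟨⟨hb.1.le, hb.2⟩, ⟨by linarith [P.ρ_pos], P.ρ_pos.le⟩⟩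
  rcases le_total β β' with h | h
  · exact P.mem_leaf_of_horizontal hι h (hr hβ) (hr hβ') (Or.inr hβ.1) hx hy
  · rw [mem_leaf_comm]
    exact P.mem_leaf_of_horizontal hι h (hr hβ') (hr hβ) (Or.inr hβ'.1) hy hx

/-- **A leaf through a point of a sector at a nonzero height reaches the outer edge of the
sector at that height.** [folklore] -/
theorem exists_mem_leaf_outer {j : ZMod n} {x : X} (hx : ι x ∈ P.S j) (hH : P.H (ι x) ≠ 0) :
    ∃ y ∈ F.leaf x, ι y = P.pt j (P.ρ, P.H (ι x)) := by
  have hrect := P.chart_mem_rect hx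
  rw [P.chart_apply, P.mem_rect_iff] at hrect
  have hout : ((P.ρ, P.H (ι x)) : ℝ × ℝ) ∈ P.rect := ⟨⟨P.ρ_pos.le, le_rfl⟩, hrect.2⟩
  have hne : ((P.ρ, P.H (ι x)) : ℝ × ℝ) ≠ 0 := fun h ↦ hH (congrArg Prod.snd h)
  obtain ⟨y, hy⟩ := P.exists_eq_of_mem (P.pt_mem hout) (P.pt_ne hout hne)
  refine ⟨y, ?_, hy⟩
  have hx' : ι x = P.pt j (P.b j (ι x), P.H (ι x)) := by
    rw [show (P.b j (ι x), P.H (ι x)) = P.chart j (ι x) from rfl, P.pt_chart hx]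
  exact P.mem_leaf_of_horizontal hι hrect.1.2 ⟨hrect.1, hrect.2⟩ hout (Or.inl hH) hx' hy

/-- **A leaf that stays close to `v` meets the star only along the prongs**: with `c` as in
`exists_le_dist`, if every point of the leaf of `x` in the sector `j` is within distance `c`
of `v`, then a point of the leaf in the sector `j` has height `0`. [folklore] -/
theorem H_eq_zero_of_forall_dist_lt {c : ℝ} (hc : ∀ j, ∀ z ∈ P.S j, P.ρ / 2 ≤ P.b j z → c ≤ dist z v)
    {j : ZMod n} {x : X} (hx : ι x ∈ P.S j) (hclose : ∀ y ∈ F.leaf x, ι y ∈ P.S j → dist (ι y) v < c) :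
    P.H (ι x) = 0 := by
  by_contra hH
  obtain ⟨y, hy, hιy⟩ := P.exists_mem_leaf_outer hι hx hH
  have hrect := P.chart_mem_rect hx
  rw [P.chart_apply, P.mem_rect_iff] at hrect
  have hout : ((P.ρ, P.H (ι x)) : ℝ × ℝ) ∈ P.rect := ⟨⟨P.ρ_pos.le, le_rfl⟩, hrect.2⟩
  have hyS : ι y ∈ P.S j := by rw [hιy]; exact P.pt_mem hout
  have hb : P.ρ / 2 ≤ P.b j (ι y) := by rw [hιy, P.b_pt hout]; linarith [P.ρ_pos]
  have h₁ := hc j (ι y) hyS hb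
  have h₂ := hclose y hy hyS
  linarith

end Leaves

/-! ## The axes -/

/-- A point of the axis of a sector lies in a neighbouring sector. [folklore] -/
theorem mem_neighbour_of_b_eq_zero {j : ZMod n} {z : ℂ} (hz : z ∈ P.S j) (hb : P.b j z = 0) :
    z ∈ P.S (j - 1) ∨ z ∈ P.S (j + 1) :=
  P.axis_subset j ⟨hz, hb⟩

/-- A point shared with the next sector is on both axes, on the half selected by the sign.
[folklore] -/
theorem b_eq_zero_of_mem_inter {j : ZMod n} {z : ℂ} (hz : z ∈ P.S j ∩ P.S (j + 1)) :
    P.b j z = 0 ∧ P.b (j + 1) z = 0 ∧ 0 ≤ P.sg j * P.H z := by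
  have h₁ := hz
  have h₂ := hz
  rw [P.inter_succ j] at h₁
  rw [P.inter_succ' j] at h₂
  exact ⟨h₁.2.1, h₂.2.1, h₁.2.2⟩

/-- A point of the sector `j` on its axis with `0 ≤ sg j * H` lies in the next sector.
[folklore] -/
theorem mem_succ_of_b_eq_zero {j : ZMod n} {z : ℂ} (hz : z ∈ P.S j) (hb : P.b j z = 0) (hs : 0 ≤ P.sg j * P.H z) :
    z ∈ P.S (j + 1) := by
  have : z ∈ P.S j ∩ P.S (j + 1) := by rw [P.inter_succ j]; exact ⟨hz, hb, hs⟩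
  exact this.2

/-- A point of the sector `j + 1` on its axis with `0 ≤ sg j * H` lies in the sector `j`.
[folklore] -/
theorem mem_of_b_succ_eq_zero {j : ZMod n} {z : ℂ} (hz : z ∈ P.S (j + 1)) (hb : P.b (j + 1) z = 0)
    (hs : 0 ≤ P.sg j * P.H z) : z ∈ P.S j := by
  have : z ∈ P.S j ∩ P.S (j + 1) := by rw [P.inter_succ' j]; exact ⟨hz, hb, hs⟩
  exact this.1

/-- The signs are nonzero. [folklore] -/
theorem sg_ne_zero (j : ZMod n) : P.sg j ≠ 0 := by
  rcases P.sg_sq j with h | h <;> rw [h] <;> norm_num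

/-- **A point of an axis at nonzero height lies in exactly the neighbour selected by the sign of
its height**: if `z ∈ S j`, `b j z = 0` and `sg j * H z < 0`, then `z ∈ S (j - 1)` with
`b (j - 1) z = 0`. [folklore] -/
theorem mem_pred_of_b_eq_zero {j : ZMod n} {z : ℂ} (hz : z ∈ P.S j) (hb : P.b j z = 0) (hs : P.sg j * P.H z < 0) :
    z ∈ P.S (j - 1) ∧ P.b (j - 1) z = 0 := by
  rcases P.mem_neighbour_of_b_eq_zero hz hb with h | h
  · have hz' : z ∈ P.S (j - 1) ∩ P.S (j - 1 + 1) := by rw [sub_add_cancel]; exact ⟨h, hz⟩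
    have := P.b_eq_zero_of_mem_inter hz'
    exact ⟨h, this.1⟩
  · have := P.b_eq_zero_of_mem_inter ⟨hz, h⟩
    linarith [this.2.2]

end ProngStar

end Literature.Topology.PlanarFoliations
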